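import Literature.AlgebraicGeometry.Milne1999.LefschetzGroupOnePowers
import HarnessLib

/-!
# `ker l(B × C)|_{H¹}` and `L(B × C)(ℂ)|_{H¹}` are block diagonal; Thm. 4.4 on `H¹` for the product polarization;
# `S(B × C) ≅ S(B) × S(C)` and `L(B × C)|_{H¹} ≅ G(B) ×_{𝔾_m} G(C)` for Hom-orthogonal factors
# (Milne 1999, §1 p. 643, Prop. 1.5, Thm. 4.4, Def. 4.6, Cor. 4.7 — binary case, read on `H¹`)

Milne [Milne1999LefschetzClasses, §1 p. 643]: «Let `A = A₁ × ⋯ × A_s`. Then `C(A) ⊂ C(A₁) × ⋯ × C(A_s)`, with equality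
holding if and only if `Hom(Aᵢ, Aⱼ) = 0` for all `i ≠ j`. Moreover, if `Dᵢ` is an ample divisor on `Aᵢ` […]
`D = Σᵢ A₁ × ⋯ × Dᵢ × ⋯ × A_s` is an ample divisor on `A`, and the involution it defines on `C(A)` is the restriction of the
product of the involutions»; Prop. 1.5 («`S(A₁) × ⋯ × S(A_s) → S(A)` is an isomorphism»); Thm. 4.4 (`ker l(A) = S(A)`,
`L(A) ≅ G(A)`); Def. 4.6 (the product `∏ (Gᵢ, tᵢ)` = largest subgroup of `∏ Gᵢ` on which the characters agree);
Cor. 4.7 («an isogeny `A → A₁^{r₁} × ⋯ × A_s^{r_s}` […] defines an isomorphism `(L(A), l(A)) → ∏ᵢ (L(Aᵢ), l(Aᵢ))`»).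

The tree has the centraliser side in full (`Milne1999/LefschetzCentraliserProducts`: `C(B × C)` is block diagonal,
`centralizerGroup.restrictFstHom / restrictSndHom`, `prodBlockDiagEquiv`; `Milne1999/LefschetzGroupProducts`: the block form
of `Q_D`, `mem_unitaryCentralizerGroup_prod_iff`, `mem_similitudeCentralizerGroup_prod_iff`, `similitudeCentralizerGroupFibreProd`,
`unitaryCentralizerGroup.prodMulEquiv`, `similitudeCentralizerGroup.prodMulEquiv` for `Hom(B, C) = 0 = Hom(C, B)`), the four
properties of the product class `pr_B^* h_B + pr_C^* h_C` (`prodPolarizationClass_mem_hodgeClassSpan`,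
`lefschetzPow_prodPolarizationClass_self_ne_zero`, `eq_zero_of_forall_polarizationPairingOne_prod_eq_zero`,
`isRationalClass_prodPolarizationClass`, `isOfHodgeType_prodPolarizationClass`) and Thm. 4.4 on `H¹` from the four
properties (`specialLefschetzGroup_map_one_eq_unitaryCentralizerGroup_of_nondegenerate`). This file (all `theorem`s,
no definition, no named fact) reads them on Milne's LEFSCHETZ GROUPS of the product:
* §1 `u = u_B ⊕ u_C` for `u ∈ C(B × C)` as an identity of automorphisms; **Thm. 4.4 on `H¹` for `pr_B^* h_B + pr_C^* h_C`
  on `B × C`** — `{g₁ | g ∈ ker l(B × C)(ℂ)} = S(B × C)(pr_B^* h_B + pr_C^* h_C)(ℂ)` and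
  `L(B × C)(ℂ)|_{H¹} = G(B × C)(pr_B^* h_B + pr_C^* h_C)(ℂ)` — from the four properties of `h_B`, `h_C`, in
  particular for `IsPolarizationClass`es;
* §2 **block diagonality, no hypothesis on `Hom`**: every element of `{g₁ | g ∈ ker l(B × C)(ℂ)}` is `s ⊕ t` with
  `s ∈ {g₁ | g ∈ ker l(B)}`, `t ∈ {g₁ | g ∈ ker l(C)}`, and every element of `L(B × C)(ℂ)|_{H¹}` is `s ⊕ t` with
  `s ∈ L(B)(ℂ)|_{H¹}`, `t ∈ L(C)(ℂ)|_{H¹}` («`C(A) ⊂ C(A₁) × C(A₂)`» read on `ker l` and `L`; class-free statements);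
* §3 **`Hom(B, C) = 0 = Hom(C, B)`**: `s ⊕ t ∈ {g₁ | g ∈ ker l(B × C)} ⟺ s ∈ {g₁ | g ∈ ker l(B)} ∧ t ∈ {g₁ | g ∈ ker l(C)}`,
  **`{g₁ | g ∈ ker l(B × C)(ℂ)} ≅ {g₁ | g ∈ ker l(B)(ℂ)} × {g₁ | g ∈ ker l(C)(ℂ)}`** (Prop. 1.5 / Cor. 4.7 on `ker l`, binary, on
  `H¹`) and **`L(B × C)(ℂ)|_{H¹} ≅ G(B)(h_B) ×_{𝔾_m} G(C)(h_C)`** (Cor. 4.7 with Def. 4.6) as abstract groups;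
* §4 **`MT(B × C)(ℂ)|_{H¹} ⊓ S(B × C)(pr_B^* h_B + pr_C^* h_C)(ℂ) = Hg(B × C)(ℂ)|_{H¹}`** and
  `MT(B × C)|_{H¹} ⊔ S(B × C)(pr_B^* h_B + pr_C^* h_C) = L(B × C)|_{H¹}` for polarization classes `h_B`, `h_C`
  (the pull-back square `Hg = MT ∩ ker l`, `L = MT · ker l` of `Milne1999/MumfordTateGroupMeetSpecialLefschetzGroup` for the
  product class, which the tree does not know to be an `IsPolarizationClass`).

## References

* [Milne1999LefschetzClasses] J. S. Milne, *Lefschetz classes on abelian varieties*, Duke Math. J. 96 (1999), §1 p. 643,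
  Prop. 1.5 (p. 644), Thm. 4.4, Def. 4.6, Cor. 4.7 (pp. 659–660), p. 658 (proof of Cor. 4.2).
* [LangeBirkenhake1992] H. Lange, Ch. Birkenhake, *Complex Abelian Varieties* (1992), §5.3 (product polarization).
* [MoonenZarhin1999LowDim] B. Moonen, Yu. G. Zarhin, Math. Ann. 315 (1999), §3 (3.1) (`Hg(X₁ × X₂) ⊂ Hg(X₁) × Hg(X₂)`).
-/

noncomputable section

open CategoryTheory
open Literature.AlgebraicTopology.SingularHomology
open Literature.AlgebraicGeometry.Motives
open Literature.AlgebraicGeometry.HodgeTheory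
open Literature.AlgebraicGeometry.VanGeemen1994 (hodgeGroupOne mem_hodgeGroupOne_iff hodgeClassSpan)
open Literature.Geometry.Kaehler (lefschetzPow)

namespace Literature.AlgebraicGeometry.Milne1999

variable {B C : AbelianVariety ℂ} {hB : complexBetti B.X 2} {hC : complexBetti C.X 2}

/-! ### §1 `C(B × C)` is block diagonal (as automorphisms); Thm. 4.4 on `H¹` for the product polarization -/

section ThmFourFour

/-- **`u = u_B ⊕ u_C` for `u ∈ C(B × C)`**, as an identity of automorphisms of `H¹((B × C)(ℂ); ℂ)` (the tree's
`prodBlockDiag_eq_of_mem_centralizerGroup` on `LinearEquiv`s). [cite: Milne1999LefschetzClasses, §1 p. 643 (C(A) ⊂ C(A₁) × C(A₂))] -/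
theorem centralizerGroup.prodBlockDiagEquiv_restrictHom (u : centralizerGroup (B.prod C)) :
    prodBlockDiagEquiv (centralizerGroup.restrictFstHom B C u) (centralizerGroup.restrictSndHom B C u) =
      (u : complexBetti (B.prod C).X 1 ≃ₗ[ℂ] complexBetti (B.prod C).X 1) :=
  LinearEquiv.toLinearMap_injective (by
    rw [coe_prodBlockDiagEquiv, centralizerGroup.coe_restrictFstHom, centralizerGroup.coe_restrictSndHom]
    exact prodBlockDiag_eq_of_mem_centralizerGroup u.2)

variable (B C) in
/-- **Milne 1999, Thm. 4.4 on `H¹` for the product polarization `pr_B^* h_B + pr_C^* h_C` of `B × C`** from the four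
properties of `h_B` and `h_C` (rational, type `(1,1)`, top power `≠ 0`, `Q` non-degenerate):
`{g₁ | g ∈ ker l(B × C)(ℂ)} = S(B × C)(pr_B^* h_B + pr_C^* h_C)(ℂ)`. [cite: Milne1999LefschetzClasses, Thm. 4.4 and §1 p. 643]
[cite: LangeBirkenhake1992, §5.3] -/
theorem specialLefschetzGroup_map_one_prod_eq_unitaryCentralizerGroup
    (hQB : IsRationalClass hB) (h11B : IsOfHodgeType B.dim B.X 2 1 1 hB) (hBtop : lefschetzPow hB (B.dim - 1) 2 hB ≠ 0)
    (hndB : ∀ x : complexBetti B.X 1, (∀ y, polarizationPairingOne B.X hB (B.dim - 1) x y = 0) → x = 0)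
    (hQC : IsRationalClass hC) (h11C : IsOfHodgeType C.dim C.X 2 1 1 hC) (hCtop : lefschetzPow hC (C.dim - 1) 2 hC ≠ 0)
    (hndC : ∀ x : complexBetti C.X 1, (∀ y, polarizationPairingOne C.X hC (C.dim - 1) x y = 0) → x = 0) :
    (specialLefschetzGroup (B.prod C).dim (B.prod C).X).map
        (Pi.evalMonoidHom (fun k : ℕ ↦ complexBetti (B.prod C).X k ≃ₗ[ℂ] complexBetti (B.prod C).X k) 1) =
      unitaryCentralizerGroup (B.prod C) (prodPolarizationClass B C hB hC) := by
  have hB0 : 0 < B.dim := dim_pos_of_lefschetzPow_ne_zero hBtop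
  have hC0 : 0 < C.dim := dim_pos_of_lefschetzPow_ne_zero hCtop
  have hBC : 1 ≤ (B.prod C).dim := by rw [AbelianVariety.dim_prod]; omega
  exact specialLefschetzGroup_map_one_eq_unitaryCentralizerGroup_of_nondegenerate (B.prod C) hBC
    (isRationalClass_prodPolarizationClass hQB hQC) (isOfHodgeType_prodPolarizationClass h11B h11C)
    (lefschetzPow_prodPolarizationClass_self_ne_zero hB hC hB0 hC0 hBtop hCtop)
    (eq_zero_of_forall_polarizationPairingOne_prod_eq_zero hB hC hB0 hC0 hBtop hCtop hndB hndC)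

/-- **Thm. 4.4 on `H¹` for `pr_B^* h_B + pr_C^* h_C`, `h_B`, `h_C` polarization classes** (`dim B, dim C ≥ 1`).
[cite: Milne1999LefschetzClasses, Thm. 4.4 and §1 p. 643] [cite: Andre1996Motifs, §1.1 (p. 10)] -/
theorem specialLefschetzGroup_map_one_prod_eq_unitaryCentralizerGroup_of_isPolarizationClass
    (hpolB : IsPolarizationClass B.dim B.X hB) (hpolC : IsPolarizationClass C.dim C.X hC) (hB1 : 1 ≤ B.dim)
    (hC1 : 1 ≤ C.dim) :
    (specialLefschetzGroup (B.prod C).dim (B.prod C).X).map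
        (Pi.evalMonoidHom (fun k : ℕ ↦ complexBetti (B.prod C).X k ≃ₗ[ℂ] complexBetti (B.prod C).X k) 1) =
      unitaryCentralizerGroup (B.prod C) (prodPolarizationClass B C hB hC) :=
  specialLefschetzGroup_map_one_prod_eq_unitaryCentralizerGroup B C hpolB.isRationalClass
    (isOfHodgeType_of_mem_algebraicClasses_of_isSmoothProjective AbelianVariety.isSmoothProjective_holds 1
      hpolB.mem_algebraicClasses)
    (AbelianVariety.lefschetzPow_self_ne_zero_of_hasHardLefschetzProperty hB1 hpolB.hasHardLefschetz)
    (fun _ hx ↦ eq_zero_of_forall_polarizationPairingOne_eq_zero_of_hasHardLefschetzProperty hB1 hpolB.hasHardLefschetz hx)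
    hpolC.isRationalClass
    (isOfHodgeType_of_mem_algebraicClasses_of_isSmoothProjective AbelianVariety.isSmoothProjective_holds 1
      hpolC.mem_algebraicClasses)
    (AbelianVariety.lefschetzPow_self_ne_zero_of_hasHardLefschetzProperty hC1 hpolC.hasHardLefschetz)
    (fun _ hx ↦ eq_zero_of_forall_polarizationPairingOne_eq_zero_of_hasHardLefschetzProperty hC1 hpolC.hasHardLefschetz hx)

/-- **`L(B × C)(ℂ)|_{H¹} = G(B × C)(pr_B^* h_B + pr_C^* h_C)(ℂ)`** for polarization classes `h_B`, `h_C` (`dim B, dim C ≥ 1`).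
[cite: Milne1999LefschetzClasses, Thm. 4.4, §4 p. 659 and Cor. 4.7] -/
theorem lefschetzGroup_map_one_prod_eq_similitudeCentralizerGroup_of_isPolarizationClass
    (hpolB : IsPolarizationClass B.dim B.X hB) (hpolC : IsPolarizationClass C.dim C.X hC) (hB1 : 1 ≤ B.dim)
    (hC1 : 1 ≤ C.dim) :
    (lefschetzGroup (B.prod C).dim (B.prod C).X).map
        (Pi.evalMonoidHom (fun k : ℕ ↦ complexBetti (B.prod C).X k ≃ₗ[ℂ] complexBetti (B.prod C).X k) 1) =
      similitudeCentralizerGroup (B.prod C) (prodPolarizationClass B C hB hC) :=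
  lefschetzGroup_map_one_eq_similitudeCentralizerGroup_of_eq
    (prodPolarizationClass_mem_hodgeClassSpan hB hC hpolB.mem_hodgeClassSpan_one hpolC.mem_hodgeClassSpan_one)
    (specialLefschetzGroup_map_one_prod_eq_unitaryCentralizerGroup_of_isPolarizationClass hpolB hpolC hB1 hC1)

end ThmFourFour

/-! ### §2 `ker l(B × C)|_{H¹}` and `L(B × C)|_{H¹}` are block diagonal (no hypothesis on `Hom`) -/

section BlockDiagonal

/-- **`S(B × C)(pr_B^* h_B + pr_C^* h_C)(ℂ) ∋ U ⟹ U = s ⊕ t`, `s ∈ S(B)(h_B)(ℂ)`, `t ∈ S(C)(h_C)(ℂ)`** (`h_B^{dim B} ≠ 0 ≠ h_C^{dim C}`):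
«`C(A) ⊂ C(A₁) × C(A₂)`» and the block form of `Q_D`. [cite: Milne1999LefschetzClasses, §1 p. 643 and Prop. 1.5]
[cite: LangeBirkenhake1992, §5.3] -/
theorem exists_eq_prodBlockDiagEquiv_of_mem_unitaryCentralizerGroup_prod (hBtop : lefschetzPow hB (B.dim - 1) 2 hB ≠ 0)
    (hCtop : lefschetzPow hC (C.dim - 1) 2 hC ≠ 0)
    {U : complexBetti (B.prod C).X 1 ≃ₗ[ℂ] complexBetti (B.prod C).X 1}
    (hU : U ∈ unitaryCentralizerGroup (B.prod C) (prodPolarizationClass B C hB hC)) :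
    ∃ s ∈ unitaryCentralizerGroup B hB, ∃ t ∈ unitaryCentralizerGroup C hC, prodBlockDiagEquiv s t = U := by
  have h := (mem_unitaryCentralizerGroup_prod_iff hBtop hCtop ⟨U, hU.1⟩).1 hU
  exact ⟨_, h.1, _, h.2, centralizerGroup.prodBlockDiagEquiv_restrictHom ⟨U, hU.1⟩⟩

/-- **`G(B × C)(pr_B^* h_B + pr_C^* h_C)(ℂ) ∋ U ⟹ U = s ⊕ t`, `s ∈ G(B)(h_B)(ℂ)`, `t ∈ G(C)(h_C)(ℂ)` with a COMMON multiplier**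
(`h_B^{dim B} ≠ 0 ≠ h_C^{dim C}`), i.e. `(s, t)` in Milne's fibre product of Def. 4.6.
[cite: Milne1999LefschetzClasses, §1 p. 643, Def. 4.6 and Cor. 4.7] -/
theorem exists_eq_prodBlockDiagEquiv_of_mem_similitudeCentralizerGroup_prod
    (hBtop : lefschetzPow hB (B.dim - 1) 2 hB ≠ 0) (hCtop : lefschetzPow hC (C.dim - 1) 2 hC ≠ 0)
    {U : complexBetti (B.prod C).X 1 ≃ₗ[ℂ] complexBetti (B.prod C).X 1}
    (hU : U ∈ similitudeCentralizerGroup (B.prod C) (prodPolarizationClass B C hB hC)) :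
    ∃ p ∈ similitudeCentralizerGroupFibreProd B C hB hC, prodBlockDiagEquiv p.1 p.2 = U := by
  obtain ⟨c, hc₁, hc₂⟩ := (mem_similitudeCentralizerGroup_prod_iff hBtop hCtop ⟨U, hU.1⟩).1 hU
  exact ⟨(centralizerGroup.restrictFstHom B C ⟨U, hU.1⟩, centralizerGroup.restrictSndHom B C ⟨U, hU.1⟩),
    ⟨centralizerGroup.restrictFstHom_mem _, centralizerGroup.restrictSndHom_mem _, c, hc₁, hc₂⟩,
    centralizerGroup.prodBlockDiagEquiv_restrictHom ⟨U, hU.1⟩⟩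

variable (B C)

/-- **`{g₁ | g ∈ ker l(B × C)(ℂ)} ∋ U ⟹ U = s ⊕ t` with `s ∈ {g₁ | g ∈ ker l(B)(ℂ)}`, `t ∈ {g₁ | g ∈ ker l(C)(ℂ)}`** for all
complex abelian varieties `B`, `C` of positive dimension — no class and no hypothesis on `Hom` (Thm. 4.4 on `H¹` for
polarizations of `B`, `C` and their product class). [cite: Milne1999LefschetzClasses, §1 p. 643, Prop. 1.5 and Thm. 4.4] -/
theorem exists_eq_prodBlockDiagEquiv_of_mem_map_specialLefschetzGroup_one_prod (hB1 : 1 ≤ B.dim) (hC1 : 1 ≤ C.dim)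
    {U : complexBetti (B.prod C).X 1 ≃ₗ[ℂ] complexBetti (B.prod C).X 1}
    (hU : U ∈ (specialLefschetzGroup (B.prod C).dim (B.prod C).X).map
        (Pi.evalMonoidHom (fun k : ℕ ↦ complexBetti (B.prod C).X k ≃ₗ[ℂ] complexBetti (B.prod C).X k) 1)) :
    ∃ s ∈ (specialLefschetzGroup B.dim B.X).map
        (Pi.evalMonoidHom (fun k : ℕ ↦ complexBetti B.X k ≃ₗ[ℂ] complexBetti B.X k) 1),
      ∃ t ∈ (specialLefschetzGroup C.dim C.X).map
        (Pi.evalMonoidHom (fun k : ℕ ↦ complexBetti C.X k ≃ₗ[ℂ] complexBetti C.X k) 1), prodBlockDiagEquiv s t = U := by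
  obtain ⟨hB, hpolB⟩ := exists_isPolarizationClass (AbelianVariety.isSmoothProjective_holds (A := B))
  obtain ⟨hC, hpolC⟩ := exists_isPolarizationClass (AbelianVariety.isSmoothProjective_holds (A := C))
  rw [specialLefschetzGroup_map_one_prod_eq_unitaryCentralizerGroup_of_isPolarizationClass hpolB hpolC hB1 hC1] at hU
  rw [hpolB.specialLefschetzGroup_map_one_eq hB1, hpolC.specialLefschetzGroup_map_one_eq hC1]
  exact exists_eq_prodBlockDiagEquiv_of_mem_unitaryCentralizerGroup_prod
    (AbelianVariety.lefschetzPow_self_ne_zero_of_hasHardLefschetzProperty hB1 hpolB.hasHardLefschetz)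
    (AbelianVariety.lefschetzPow_self_ne_zero_of_hasHardLefschetzProperty hC1 hpolC.hasHardLefschetz) hU

/-- **`L(B × C)(ℂ)|_{H¹} ∋ U ⟹ U = s ⊕ t` with `s ∈ L(B)(ℂ)|_{H¹}`, `t ∈ L(C)(ℂ)|_{H¹}`** for all complex abelian varieties `B`, `C`
of positive dimension — no class and no hypothesis on `Hom` («`L(A × B) ⊂ L(A) × L(B)`» on `H¹`).
[cite: Milne1999LefschetzClasses, §1 p. 643, §4 pp. 658–659 and Cor. 4.7] [cite: MoonenZarhin1999LowDim, §3 (3.1)] -/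
theorem exists_eq_prodBlockDiagEquiv_of_mem_map_lefschetzGroup_one_prod (hB1 : 1 ≤ B.dim) (hC1 : 1 ≤ C.dim)
    {U : complexBetti (B.prod C).X 1 ≃ₗ[ℂ] complexBetti (B.prod C).X 1}
    (hU : U ∈ (lefschetzGroup (B.prod C).dim (B.prod C).X).map
        (Pi.evalMonoidHom (fun k : ℕ ↦ complexBetti (B.prod C).X k ≃ₗ[ℂ] complexBetti (B.prod C).X k) 1)) :
    ∃ s ∈ (lefschetzGroup B.dim B.X).map
        (Pi.evalMonoidHom (fun k : ℕ ↦ complexBetti B.X k ≃ₗ[ℂ] complexBetti B.X k) 1),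
      ∃ t ∈ (lefschetzGroup C.dim C.X).map
        (Pi.evalMonoidHom (fun k : ℕ ↦ complexBetti C.X k ≃ₗ[ℂ] complexBetti C.X k) 1), prodBlockDiagEquiv s t = U := by
  obtain ⟨hB, hpolB⟩ := exists_isPolarizationClass (AbelianVariety.isSmoothProjective_holds (A := B))
  obtain ⟨hC, hpolC⟩ := exists_isPolarizationClass (AbelianVariety.isSmoothProjective_holds (A := C))
  rw [lefschetzGroup_map_one_prod_eq_similitudeCentralizerGroup_of_isPolarizationClass hpolB hpolC hB1 hC1] at hU
  rw [hpolB.lefschetzGroup_map_one_eq hB1, hpolC.lefschetzGroup_map_one_eq hC1]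
  obtain ⟨p, hp, e⟩ := exists_eq_prodBlockDiagEquiv_of_mem_similitudeCentralizerGroup_prod
    (AbelianVariety.lefschetzPow_self_ne_zero_of_hasHardLefschetzProperty hB1 hpolB.hasHardLefschetz)
    (AbelianVariety.lefschetzPow_self_ne_zero_of_hasHardLefschetzProperty hC1 hpolC.hasHardLefschetz) hU
  have hp' := similitudeCentralizerGroupFibreProd_le_prod hp
  exact ⟨p.1, (Subgroup.mem_prod.1 hp').1, p.2, (Subgroup.mem_prod.1 hp').2, e⟩

end BlockDiagonal

/-! ### §3 Hom-orthogonal factors: `ker l(B × C)|_{H¹} ≅ ker l(B)|_{H¹} × ker l(C)|_{H¹}`, `L(B × C)|_{H¹} ≅ G(B) ×_{𝔾_m} G(C)` -/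

section HomOrthogonal

variable (B C)

/-- **`s ⊕ t ∈ {g₁ | g ∈ ker l(B × C)(ℂ)} ⟺ s ∈ {g₁ | g ∈ ker l(B)(ℂ)} ∧ t ∈ {g₁ | g ∈ ker l(C)(ℂ)}`** for
`Hom(B, C) = 0 = Hom(C, B)` (`dim B, dim C ≥ 1`; Milne Prop. 1.5, binary case, on `ker l`).
[cite: Milne1999LefschetzClasses, §1 p. 643, Prop. 1.5 and Thm. 4.4] -/
theorem prodBlockDiagEquiv_mem_map_specialLefschetzGroup_one_prod_iff (hBC : ∀ f : B ⟶ C, f = 0)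
    (hCB : ∀ g : C ⟶ B, g = 0) (hB1 : 1 ≤ B.dim) (hC1 : 1 ≤ C.dim) (s : complexBetti B.X 1 ≃ₗ[ℂ] complexBetti B.X 1)
    (t : complexBetti C.X 1 ≃ₗ[ℂ] complexBetti C.X 1) :
    prodBlockDiagEquiv s t ∈ (specialLefschetzGroup (B.prod C).dim (B.prod C).X).map
        (Pi.evalMonoidHom (fun k : ℕ ↦ complexBetti (B.prod C).X k ≃ₗ[ℂ] complexBetti (B.prod C).X k) 1) ↔
      s ∈ (specialLefschetzGroup B.dim B.X).map
          (Pi.evalMonoidHom (fun k : ℕ ↦ complexBetti B.X k ≃ₗ[ℂ] complexBetti B.X k) 1) ∧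
        t ∈ (specialLefschetzGroup C.dim C.X).map
          (Pi.evalMonoidHom (fun k : ℕ ↦ complexBetti C.X k ≃ₗ[ℂ] complexBetti C.X k) 1) := by
  obtain ⟨hB, hpolB⟩ := exists_isPolarizationClass (AbelianVariety.isSmoothProjective_holds (A := B))
  obtain ⟨hC, hpolC⟩ := exists_isPolarizationClass (AbelianVariety.isSmoothProjective_holds (A := C))
  have hBtop := AbelianVariety.lefschetzPow_self_ne_zero_of_hasHardLefschetzProperty hB1 hpolB.hasHardLefschetz
  have hCtop := AbelianVariety.lefschetzPow_self_ne_zero_of_hasHardLefschetzProperty hC1 hpolC.hasHardLefschetz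
  rw [specialLefschetzGroup_map_one_prod_eq_unitaryCentralizerGroup_of_isPolarizationClass hpolB hpolC hB1 hC1,
    hpolB.specialLefschetzGroup_map_one_eq hB1, hpolC.specialLefschetzGroup_map_one_eq hC1]
  constructor
  · intro h
    obtain ⟨s', hs', t', ht', e⟩ := exists_eq_prodBlockDiagEquiv_of_mem_unitaryCentralizerGroup_prod hBtop hCtop h
    have hmem : prodBlockDiagEquiv s' t' ∈ centralizerGroup (B.prod C) := by rw [e]; exact h.1
    have hmem' : prodBlockDiagEquiv s t ∈ centralizerGroup (B.prod C) := h.1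
    have es : s' = s := by
      rw [← centralizerGroup.restrictFstHom_prodBlockDiagEquiv hmem, ← centralizerGroup.restrictFstHom_prodBlockDiagEquiv hmem']
      congr 1
      exact Subtype.ext e
    have et : t' = t := by
      rw [← centralizerGroup.restrictSndHom_prodBlockDiagEquiv hmem, ← centralizerGroup.restrictSndHom_prodBlockDiagEquiv hmem']
      congr 1
      exact Subtype.ext e
    exact ⟨es ▸ hs', et ▸ ht'⟩
  · rintro ⟨hs, ht⟩
    exact prodBlockDiagEquiv_mem_unitaryCentralizerGroup hBC hCB hBtop hCtop hs ht

/-- **`{g₁ | g ∈ ker l(B × C)(ℂ)} ≅ {g₁ | g ∈ ker l(B)(ℂ)} × {g₁ | g ∈ ker l(C)(ℂ)}`, `u ↦ (u_B, u_C)`, for `Hom(B, C) = 0 = Hom(C, B)`**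
(`dim B, dim C ≥ 1`) — Milne's Prop. 1.5 / Cor. 4.7 restricted to `ker l`, binary case, on `H¹`, as abstract groups (the
tree's `unitaryCentralizerGroup.prodMulEquiv` moved through Thm. 4.4 on the three varieties).
[cite: Milne1999LefschetzClasses, Prop. 1.5, Thm. 4.4, Cor. 4.7 and p. 658 (proof of Cor. 4.2)] -/
theorem nonempty_map_specialLefschetzGroup_one_prod_mulEquiv (hBC : ∀ f : B ⟶ C, f = 0) (hCB : ∀ g : C ⟶ B, g = 0)
    (hB1 : 1 ≤ B.dim) (hC1 : 1 ≤ C.dim) :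
    Nonempty ((specialLefschetzGroup (B.prod C).dim (B.prod C).X).map
        (Pi.evalMonoidHom (fun k : ℕ ↦ complexBetti (B.prod C).X k ≃ₗ[ℂ] complexBetti (B.prod C).X k) 1) ≃*
      (specialLefschetzGroup B.dim B.X).map
          (Pi.evalMonoidHom (fun k : ℕ ↦ complexBetti B.X k ≃ₗ[ℂ] complexBetti B.X k) 1) ×
        (specialLefschetzGroup C.dim C.X).map
          (Pi.evalMonoidHom (fun k : ℕ ↦ complexBetti C.X k ≃ₗ[ℂ] complexBetti C.X k) 1)) := by
  obtain ⟨hB, hpolB⟩ := exists_isPolarizationClass (AbelianVariety.isSmoothProjective_holds (A := B))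
  obtain ⟨hC, hpolC⟩ := exists_isPolarizationClass (AbelianVariety.isSmoothProjective_holds (A := C))
  have hBtop := AbelianVariety.lefschetzPow_self_ne_zero_of_hasHardLefschetzProperty hB1 hpolB.hasHardLefschetz
  have hCtop := AbelianVariety.lefschetzPow_self_ne_zero_of_hasHardLefschetzProperty hC1 hpolC.hasHardLefschetz
  refine ⟨(MulEquiv.subgroupCongr
    (specialLefschetzGroup_map_one_prod_eq_unitaryCentralizerGroup_of_isPolarizationClass hpolB hpolC hB1 hC1)).trans
    ((unitaryCentralizerGroup.prodMulEquiv B C hB hC hBC hCB hBtop hCtop).trans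
      ((Subgroup.prodEquiv _ _).trans (MulEquiv.prodCongr
        (MulEquiv.subgroupCongr (hpolB.specialLefschetzGroup_map_one_eq hB1).symm)
        (MulEquiv.subgroupCongr (hpolC.specialLefschetzGroup_map_one_eq hC1).symm))))⟩

/-- **`L(B × C)(ℂ)|_{H¹} ≅ G(B)(h_B) ×_{𝔾_m} G(C)(h_C)`, `u ↦ (u_B, u_C)`, for `Hom(B, C) = 0 = Hom(C, B)`** and polarization classes
`h_B`, `h_C` (`dim B, dim C ≥ 1`) — Cor. 4.7 «`(L(A), l(A)) → ∏ᵢ (L(Aᵢ), l(Aᵢ))` is an isomorphism» with the product of Def. 4.6,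
binary case, on `H¹`, as abstract groups. [cite: Milne1999LefschetzClasses, Def. 4.6, Cor. 4.7 and Thm. 4.4] -/
theorem nonempty_map_lefschetzGroup_one_prod_mulEquiv_fibreProd (hBC : ∀ f : B ⟶ C, f = 0) (hCB : ∀ g : C ⟶ B, g = 0)
    (hpolB : IsPolarizationClass B.dim B.X hB) (hpolC : IsPolarizationClass C.dim C.X hC) (hB1 : 1 ≤ B.dim)
    (hC1 : 1 ≤ C.dim) :
    Nonempty ((lefschetzGroup (B.prod C).dim (B.prod C).X).map
        (Pi.evalMonoidHom (fun k : ℕ ↦ complexBetti (B.prod C).X k ≃ₗ[ℂ] complexBetti (B.prod C).X k) 1) ≃*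
      similitudeCentralizerGroupFibreProd B C hB hC) :=
  ⟨(MulEquiv.subgroupCongr
    (lefschetzGroup_map_one_prod_eq_similitudeCentralizerGroup_of_isPolarizationClass hpolB hpolC hB1 hC1)).trans
    (similitudeCentralizerGroup.prodMulEquiv B C hB hC hBC hCB
      (AbelianVariety.lefschetzPow_self_ne_zero_of_hasHardLefschetzProperty hB1 hpolB.hasHardLefschetz)
      (AbelianVariety.lefschetzPow_self_ne_zero_of_hasHardLefschetzProperty hC1 hpolC.hasHardLefschetz))⟩

/-- `{g₁ | g ∈ ker l(B × C)(ℂ)} = {s ⊕ t | s ∈ {g₁ | g ∈ ker l(B)}, t ∈ {g₁ | g ∈ ker l(C)}}` for `Hom(B, C) = 0 = Hom(C, B)`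
(`dim B, dim C ≥ 1`), as a membership criterion. [cite: Milne1999LefschetzClasses, §1 p. 643, Prop. 1.5 and Thm. 4.4] -/
theorem mem_map_specialLefschetzGroup_one_prod_iff (hBC : ∀ f : B ⟶ C, f = 0) (hCB : ∀ g : C ⟶ B, g = 0)
    (hB1 : 1 ≤ B.dim) (hC1 : 1 ≤ C.dim) (U : complexBetti (B.prod C).X 1 ≃ₗ[ℂ] complexBetti (B.prod C).X 1) :
    U ∈ (specialLefschetzGroup (B.prod C).dim (B.prod C).X).map
        (Pi.evalMonoidHom (fun k : ℕ ↦ complexBetti (B.prod C).X k ≃ₗ[ℂ] complexBetti (B.prod C).X k) 1) ↔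
      ∃ s ∈ (specialLefschetzGroup B.dim B.X).map
          (Pi.evalMonoidHom (fun k : ℕ ↦ complexBetti B.X k ≃ₗ[ℂ] complexBetti B.X k) 1),
        ∃ t ∈ (specialLefschetzGroup C.dim C.X).map
          (Pi.evalMonoidHom (fun k : ℕ ↦ complexBetti C.X k ≃ₗ[ℂ] complexBetti C.X k) 1), prodBlockDiagEquiv s t = U :=
  ⟨exists_eq_prodBlockDiagEquiv_of_mem_map_specialLefschetzGroup_one_prod B C hB1 hC1, by
    rintro ⟨s, hs, t, ht, rfl⟩
    exact (prodBlockDiagEquiv_mem_map_specialLefschetzGroup_one_prod_iff B C hBC hCB hB1 hC1 s t).2 ⟨hs, ht⟩⟩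

end HomOrthogonal

/-! ### §4 `MT(B × C)|_{H¹}` against `S(B × C)(pr_B^* h_B + pr_C^* h_C)`: `Hg = MT ∩ S`, `L = MT · S` for the product class -/

section MumfordTate

/-- **`MT(B × C)(ℂ)|_{H¹} ⊓ S(B × C)(pr_B^* h_B + pr_C^* h_C)(ℂ) = Hg(B × C)(ℂ)|_{H¹}`** for polarization classes `h_B`, `h_C`
(`dim B, dim C ≥ 1`): `Hg(B × C)|_{H¹}` fixes the Hodge class `pr_B^* h_B + pr_C^* h_C`, and a scalar `c · 1 = (c · 1) ⊕ (c · 1)`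
lies in `S(B × C)` only if its `B`-block `c · 1` lies in `S(B)(h_B)`, i.e. `c² = 1`.
[cite: Milne1999LefschetzClasses, §1 p. 643 and §4 pp. 659–660 (L(A) ⊃ Hg(A))] [cite: MoonenZarhin1999LowDim, §3 (3.1)] -/
theorem map_mumfordTateGroup_prod_inf_unitaryCentralizerGroup_eq_hodgeGroupOne
    (hpolB : IsPolarizationClass B.dim B.X hB) (hpolC : IsPolarizationClass C.dim C.X hC) (hB1 : 1 ≤ B.dim)
    (hC1 : 1 ≤ C.dim) :
    (mumfordTateGroup (B.prod C).dim (B.prod C).X).map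
        (Pi.evalMonoidHom (fun k : ℕ ↦ complexBetti (B.prod C).X k ≃ₗ[ℂ] complexBetti (B.prod C).X k) 1) ⊓
        unitaryCentralizerGroup (B.prod C) (prodPolarizationClass B C hB hC) =
      hodgeGroupOne (B.prod C).dim (B.prod C).X := by
  have hBC : 1 ≤ (B.prod C).dim := by rw [AbelianVariety.dim_prod]; omega
  refine map_mumfordTateGroup_inf_eq_hodgeGroupOne_of_le hBC
    (hodgeGroupOne_le_unitaryCentralizerGroup
      (prodPolarizationClass_mem_hodgeClassSpan hB hC hpolB.mem_hodgeClassSpan_one hpolC.mem_hodgeClassSpan_one)) ?_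
  intro c hc
  rw [← prodBlockDiagEquiv_smulOfUnit B C c] at hc
  have h1 := ((mem_unitaryCentralizerGroup_prod_iff
    (AbelianVariety.lefschetzPow_self_ne_zero_of_hasHardLefschetzProperty hB1 hpolB.hasHardLefschetz)
    (AbelianVariety.lefschetzPow_self_ne_zero_of_hasHardLefschetzProperty hC1 hpolC.hasHardLefschetz) ⟨_, hc.1⟩).1 hc).1
  rw [centralizerGroup.restrictFstHom_prodBlockDiagEquiv hc.1] at h1
  exact (Deligne1982.smulOfUnit_mem_unitaryCentralizerGroup_iff hpolB hB1).1 h1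

/-- `u ∈ Hg(B × C)(ℂ)|_{H¹}` iff `u ∈ MT(B × C)(ℂ)|_{H¹}` and `u ∈ S(B × C)(pr_B^* h_B + pr_C^* h_C)(ℂ)` (polarization classes,
positive dimensions). [cite: Milne1999LefschetzClasses, §1 p. 643 and §4 pp. 659–660] -/
theorem mem_hodgeGroupOne_prod_iff_of_isPolarizationClass (hpolB : IsPolarizationClass B.dim B.X hB)
    (hpolC : IsPolarizationClass C.dim C.X hC) (hB1 : 1 ≤ B.dim) (hC1 : 1 ≤ C.dim)
    (U : complexBetti (B.prod C).X 1 ≃ₗ[ℂ] complexBetti (B.prod C).X 1) :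
    U ∈ hodgeGroupOne (B.prod C).dim (B.prod C).X ↔
      U ∈ (mumfordTateGroup (B.prod C).dim (B.prod C).X).map
          (Pi.evalMonoidHom (fun k : ℕ ↦ complexBetti (B.prod C).X k ≃ₗ[ℂ] complexBetti (B.prod C).X k) 1) ∧
        U ∈ unitaryCentralizerGroup (B.prod C) (prodPolarizationClass B C hB hC) := by
  rw [← map_mumfordTateGroup_prod_inf_unitaryCentralizerGroup_eq_hodgeGroupOne hpolB hpolC hB1 hC1, Subgroup.mem_inf]

/-- **`MT(B × C)(ℂ)|_{H¹} ⊔ S(B × C)(pr_B^* h_B + pr_C^* h_C)(ℂ) = L(B × C)(ℂ)|_{H¹}`** for polarization classes `h_B`, `h_C`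
(`dim B, dim C ≥ 1`). [cite: Milne1999LefschetzClasses, §4 p. 659 (L = w·ker l), Thm. 4.4 and Cor. 4.7] -/
theorem map_mumfordTateGroup_prod_sup_unitaryCentralizerGroup_eq_map_lefschetzGroup
    (hpolB : IsPolarizationClass B.dim B.X hB) (hpolC : IsPolarizationClass C.dim C.X hC) (hB1 : 1 ≤ B.dim)
    (hC1 : 1 ≤ C.dim) :
    (mumfordTateGroup (B.prod C).dim (B.prod C).X).map
        (Pi.evalMonoidHom (fun k : ℕ ↦ complexBetti (B.prod C).X k ≃ₗ[ℂ] complexBetti (B.prod C).X k) 1) ⊔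
        unitaryCentralizerGroup (B.prod C) (prodPolarizationClass B C hB hC) =
      (lefschetzGroup (B.prod C).dim (B.prod C).X).map
        (Pi.evalMonoidHom (fun k : ℕ ↦ complexBetti (B.prod C).X k ≃ₗ[ℂ] complexBetti (B.prod C).X k) 1) := by
  rw [map_mumfordTateGroup_sup_unitaryCentralizerGroup_eq_similitudeCentralizerGroup
      (prodPolarizationClass_mem_hodgeClassSpan hB hC hpolB.mem_hodgeClassSpan_one hpolC.mem_hodgeClassSpan_one),
    lefschetzGroup_map_one_prod_eq_similitudeCentralizerGroup_of_isPolarizationClass hpolB hpolC hB1 hC1]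

/-- **`Hg(B × C)(ℂ)|_{H¹} = S(B × C)(pr_B^* h_B + pr_C^* h_C)(ℂ) ⟺ S(B × C)(pr_B^* h_B + pr_C^* h_C)(ℂ) ≤ MT(B × C)(ℂ)|_{H¹}`**
(polarization classes, positive dimensions). [cite: Milne1999LefschetzClasses, §4 p. 660 and Prop. 4.8] -/
theorem hodgeGroupOne_prod_eq_unitaryCentralizerGroup_iff (hpolB : IsPolarizationClass B.dim B.X hB)
    (hpolC : IsPolarizationClass C.dim C.X hC) (hB1 : 1 ≤ B.dim) (hC1 : 1 ≤ C.dim) :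
    hodgeGroupOne (B.prod C).dim (B.prod C).X = unitaryCentralizerGroup (B.prod C) (prodPolarizationClass B C hB hC) ↔
      unitaryCentralizerGroup (B.prod C) (prodPolarizationClass B C hB hC) ≤
        (mumfordTateGroup (B.prod C).dim (B.prod C).X).map
          (Pi.evalMonoidHom (fun k : ℕ ↦ complexBetti (B.prod C).X k ≃ₗ[ℂ] complexBetti (B.prod C).X k) 1) := by
  rw [← map_mumfordTateGroup_prod_inf_unitaryCentralizerGroup_eq_hodgeGroupOne hpolB hpolC hB1 hC1]
  exact ⟨fun e ↦ e ▸ inf_le_left, fun hle ↦ inf_eq_right.2 hle⟩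

end MumfordTate

end Literature.AlgebraicGeometry.Milne1999

end
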